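import Literature.MathematicalPhysics.QuantumManyBody.JelliumBoxHamiltonian
import Literature.MathematicalPhysics.QuantumManyBody.JelliumSlidingBound
import HarnessLib

/-!
# Lieb–Solovej Lemma 3.2 (decoupling of boxes): the localized energy dominates `inf_n E^n`

Topic `Literature/MathematicalPhysics/QuantumManyBody` (the charged Bose gas, `JelliumBoseGas.foldyLaw`).
Second half of the proof of [LiebSolovej2001, Lemma 3.2]: for a Bose-symmetric `N`-body wave
function `Ψ` and a box `Q_z = z + Λ_ℓ`, the energy localized in the box,
`(Ψ, H̃_z Ψ) = κ ∑ⱼ ∫_{xⱼ ∈ Q_z} |∇ⱼΨ|² + g ∫ W_z |Ψ|²`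
(`W_z` the box potential built with the cutoff `θ(· - z)`, `θ` supported in `Λ_ℓ`, and the full
smeared background), satisfies "it is clear that `(Ψ, H̃_z Ψ) ≥ inf_{n ≤ N} E^n`", where
`E^n = JelliumBoseGas.boxGroundStateEnergy κ g ρ θ ν n ℓ` is the bosonic ground-state energy of
the `n`-particle box Hamiltonian `H^n_ℓ` [LiebSolovej2001, (3.9)]. The proof: decompose
configuration space according to the set `S` of particles inside `Q_z`; on that piece freeze the
other particles, translate by `z`, and apply the variational principle for `H^{|S|}_ℓ` to the
(Bose-symmetric, `C¹`) slice — the group-extraction mechanism of the tree's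
`LiebYngvasonCellMethod.lean` (`glueEquiv`, `slice`), here for the jellium box functional.

* `JelliumBoseGas.sum_orderEmb`, `sum_pairs_orderEmb` — re-indexing sums over a subset of
  particles by an order embedding;
* `JelliumBoseGas.glueEquiv_comp_extendDomain`, `isBoseSymmetric_slice` — slices of
  Bose-symmetric functions are Bose-symmetric;
* `JelliumBoseGas.box_group_extraction` — the group-extraction inequality for `H^n_ℓ` (in `ℝ≥0∞`,
  with the constant `c₀(n) = gρ n M²‖Y_ν‖₁` added on both sides to make every term nonnegative);
* `JelliumBoseGas.sum_boxGroundStateEnergy_mul_mass_le` — **[LiebSolovej2001, Lemma 3.2],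
  the decomposition step**: `∑_S E^{|S|} ‖Ψ 𝟙_{T_S(z)}‖² ≤ (Ψ, H̃_z Ψ)`, where
  `T_S(z) = {X | xⱼ ∈ Q_z ⟺ j ∈ S}`, in real form.

## References

* [LiebSolovej2001] E. H. Lieb, J. P. Solovej, Commun. Math. Phys. 217 (2001) 127–163, Lemma 3.2
  and its proof (arXiv:cond-mat/0007425, pp. 8–9).
* [LSSY2005] (2.52)–(2.53) (the mechanism, for nonnegative pair potentials).
-/

noncomputable section

open MeasureTheory Set Filter Real
open scoped ENNReal NNReal Topology

namespace Literature.MathematicalPhysics.QuantumManyBody.JelliumBoseGas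

open BoseGas Coulomb

/-! ### Sums over a subset of particles via an order embedding -/

section Combinatorics

variable {N n : ℕ} {A : Type*} [AddCommMonoid A]

/-- The image of `univ` under an embedding with range `S` is `S`. [folklore] -/
theorem map_univ_eq_of_range (ι : Fin n ↪ Fin N) {S : Finset (Fin N)}
    (hS : Set.range ι = (S : Set (Fin N))) : Finset.univ.map ι = S := by
  ext j
  simp only [Finset.mem_map, Finset.mem_univ, true_and]
  rw [← Finset.mem_coe, ← hS, Set.mem_range]

/-- `∑_a G(ι a) = ∑_{j ∈ S} G j` for an embedding with range `S`. [folklore] -/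
theorem sum_orderEmb (ι : Fin n ↪ Fin N) {S : Finset (Fin N)} (hS : Set.range ι = (S : Set (Fin N)))
    (G : Fin N → A) : ∑ a, G (ι a) = ∑ j ∈ S, G j := by
  rw [← map_univ_eq_of_range ι hS, Finset.sum_map]

/-- `∑_a G(ι a) = ∑_j 𝟙_S(j) G j` for an embedding with range `S`. [folklore] -/
theorem sum_orderEmb_eq_sum_ite (ι : Fin n ↪ Fin N) {S : Finset (Fin N)}
    (hS : Set.range ι = (S : Set (Fin N))) (G : Fin N → A) :
    ∑ a, G (ι a) = ∑ j, if j ∈ S then G j else 0 := by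
  rw [sum_orderEmb ι hS, ← Finset.sum_filter, Finset.filter_mem_eq_inter, Finset.univ_inter]

/-- **Pair sums over a subset**: if `f i j = 0` unless both `i, j ∈ S`, and `ι : Fin n ↪o Fin N`
is an order embedding with range `S`, then `∑_{i<j} f i j = ∑_{a<b} f (ι a) (ι b)`. [folklore] -/
theorem sum_pairs_orderEmb (ι : Fin n ↪o Fin N) {S : Finset (Fin N)}
    (hS : Set.range ι = (S : Set (Fin N))) (f : Fin N → Fin N → A)
    (hf : ∀ i j, i ∉ S ∨ j ∉ S → f i j = 0) :
    ∑ i, ∑ j with i < j, f i j = ∑ a, ∑ b with a < b, f (ι a) (ι b) := by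
  have hmem : ∀ a, ι a ∈ S := fun a => by
    rw [← Finset.mem_coe, ← hS]; exact ⟨a, rfl⟩
  -- restrict the outer sum to `S`, then re-index by `ι`
  have h1 : ∑ i, ∑ j with i < j, f i j = ∑ i ∈ S, ∑ j with i < j, f i j := by
    refine (Finset.sum_subset (Finset.subset_univ S) fun i _ hi => ?_).symm
    exact Finset.sum_eq_zero fun j _ => hf i j (Or.inl hi)
  rw [h1, ← sum_orderEmb ι.toEmbedding hS]
  refine Finset.sum_congr rfl fun a _ => ?_
  -- inner sum: restrict to `S`, then re-index
  have h2 : ∑ j with ι a < j, f (ι a) j = ∑ j ∈ S with ι a < j, f (ι a) j := by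
    refine (Finset.sum_subset (fun j hj => ?_) fun j hj hjS => ?_).symm
    · simp only [Finset.mem_filter, Finset.mem_univ, true_and] at hj ⊢
      exact hj.2
    · simp only [Finset.mem_filter, Finset.mem_univ, true_and, not_and] at hj hjS
      exact hf _ _ (Or.inr fun h => hjS h hj)
  have h3 : (Finset.univ.filter fun b : Fin n => a < b).map ι.toEmbedding =
      S.filter fun j => ι a < j := by
    ext j
    simp only [Finset.mem_map, Finset.mem_filter, Finset.mem_univ, true_and,
      RelEmbedding.coe_toEmbedding]
    constructor
    · rintro ⟨b, hb, rfl⟩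
      exact ⟨hmem b, ι.lt_iff_lt.2 hb⟩
    · rintro ⟨hjS, hlt⟩
      have hj : j ∈ Set.range ι := by rw [hS]; exact hjS
      obtain ⟨b, rfl⟩ := hj
      exact ⟨b, ι.lt_iff_lt.1 hlt, rfl⟩
  change ∑ j with ι a < j, f (ι a) j = ∑ b with a < b, f (ι a) (ι b)
  rw [h2, ← h3, Finset.sum_map]
  rfl

end Combinatorics

/-! ### Slices of Bose-symmetric functions -/

section Symmetry

variable {N n : ℕ}

open Classical in
/-- Permuting the group coordinates before gluing is gluing followed by the extended permutation
of all particles (`σ` on `range ι`, identity elsewhere). [folklore] -/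
theorem glueEquiv_comp_extendDomain (ι : Fin n ↪ Fin N) (u : Space) (σ : Equiv.Perm (Fin n))
    (Y : Config n) (Z : {j // j ∉ Set.range ι} → Space) :
    glueEquiv ι u (Y ∘ σ, Z) =
      glueEquiv ι u (Y, Z) ∘ (σ.extendDomain (Equiv.ofInjective ι ι.injective)) := by
  funext j
  by_cases hj : j ∈ Set.range ι
  · obtain ⟨i, rfl⟩ := hj
    have e1 : (σ.extendDomain (Equiv.ofInjective ι ι.injective)) (ι i) = ι (σ i) := by
      have h := Equiv.Perm.extendDomain_apply_image σ (Equiv.ofInjective ι ι.injective) i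
      simpa [Equiv.ofInjective_apply] using h
    simp only [Function.comp_apply, e1, glueEquiv_apply_ι]
  · have e2 : (σ.extendDomain (Equiv.ofInjective ι ι.injective)) j = j :=
      Equiv.Perm.extendDomain_apply_not_subtype _ _ hj
    simp only [Function.comp_apply, e2, glueEquiv_apply_of_not_mem ι u _ Z j hj]

/-- **Slices of Bose-symmetric functions are Bose-symmetric.** [cite: LiebSolovej2001, Lemma 3.2
(proof, "considered as a bosonic Hamiltonian")] -/
theorem isBoseSymmetric_slice (ι : Fin n ↪ Fin N) (u : Space) {ψ : Config N → ℂ}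
    (hψ : IsBoseSymmetric ψ) (Z : {j // j ∉ Set.range ι} → Space) :
    IsBoseSymmetric (slice ι u ψ Z) := by
  intro σ Y
  unfold slice
  rw [glueEquiv_comp_extendDomain ι u σ Y Z]
  exact hψ _ _

end Symmetry

/-! ### Finiteness of the slice functionals -/

section SliceFinite

variable {n : ℕ} {ℓ : ℝ}

/-- The Neumann kinetic energy of a `C¹` function on the bounded box is finite. [folklore] -/
theorem setLIntegral_boxN_kineticDensity_ne_top {φ : Config n → ℂ} (hφ : ContDiff ℝ 1 φ) (ℓ : ℝ) :
    ∫⁻ Y in boxN n ℓ, kineticDensity φ Y ≠ ⊤ := by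
  obtain ⟨C, hC⟩ := (isCompact_closedBall (0 : Config n) (3 * |ℓ|)).exists_bound_of_continuousOn
    (hφ.continuous_fderiv one_ne_zero).continuousOn
  refine ne_top_of_le_ne_top ?_ (setLIntegral_mono measurable_const fun X hX =>
    kineticDensity_le_of_norm_fderiv_le (hC X (boxN_subset_closedBall n ℓ hX)))
  rw [setLIntegral_const]
  exact ENNReal.mul_ne_top (ENNReal.mul_ne_top (ENNReal.natCast_ne_top n)
    (ENNReal.mul_ne_top (by norm_num) (ENNReal.pow_ne_top ENNReal.ofReal_ne_top)))
    (volume_boxN_lt_top n ℓ).ne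

/-- The one-body term of a bounded-mass function is finite: `∫(∑θU)|φ|² ≤ nM²‖Y‖₁ ∫|φ|²`.
[folklore] -/
theorem setLIntegral_boxOneBody_mul_normSq_le {θ : Space → ℝ} (hθ : ∀ x, 0 ≤ θ x) {M : ℝ}
    (hM : ∀ x, θ x ≤ M) {ν : ℝ} (hν : 0 < ν) (φ : Config n → ℂ) :
    ∫⁻ Y in boxN n ℓ, ENNReal.ofReal (boxOneBody θ ν Y) * (‖φ Y‖₊ : ℝ≥0∞) ^ 2 ≤
      ENNReal.ofReal (n * (M * (M * ∫ y, yukawa ν y))) * ∫⁻ Y in boxN n ℓ, (‖φ Y‖₊ : ℝ≥0∞) ^ 2 := by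
  rw [← lintegral_const_mul' _ _ ENNReal.ofReal_ne_top]
  exact lintegral_mono fun Y => mul_le_mul' (ENNReal.ofReal_le_ofReal (boxOneBody_le hθ hM hν Y))
    le_rfl

end SliceFinite

/-! ### Group extraction for the box functional -/

section Group

variable {n N : ℕ}

/-- **Group extraction for `H^n_ℓ`** [LiebSolovej2001, Lemma 3.2 (proof); mechanism of
LSSY2005 (2.52)–(2.53)]: single out `n` of the `N` particles by `ι : Fin n ↪ Fin N`, confine them to
the translated box `z + Λ_ℓ` and constrain the other particles to a set `A`; on this region `T`,
for every Bose-symmetric `C¹` wave function `Ψ`, with `Y = (x_{ι(i)} - z)ᵢ`,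
`E^n ∫_T|Ψ|² ≤ κ ∫_T |∇_group Ψ|² + g (∫_T ∑_{i<j∈group} w(Yᵢ,Yⱼ)|Ψ|² - ρ ∫_T ∑_{i∈group} θ(Yᵢ)U(Yᵢ)|Ψ|²)
 + gρ²(½∬w) ∫_T|Ψ|²`, stated in `ℝ≥0∞` with `c₀ = gρ n M²‖Y_ν‖₁` (`≥ -E^n`) added on both
sides. Proof: glue (volume-preserving), freeze the others (Tonelli), and apply
`boxGroundStateEnergy_mul_le` to each (Bose-symmetric) slice. [cite: LiebSolovej2001, Lemma 3.2] -/
theorem box_group_extraction {κ g ρ : ℝ} (hκ : 0 ≤ κ) (hg : 0 ≤ g) (hρ : 0 ≤ ρ)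
    {θ : Space → ℝ} (hθm : Measurable θ) (hθ : ∀ x, 0 ≤ θ x) {M : ℝ} (hM : ∀ x, θ x ≤ M)
    {ν : ℝ} (hν : 0 < ν) {ℓ : ℝ} (hℓ : 0 < ℓ) (ι : Fin n ↪ Fin N) (z : Space)
    {ψ : Config N → ℂ} (hψ : ContDiff ℝ 1 ψ) (hsymm : IsBoseSymmetric ψ)
    (A : Set ({j // j ∉ Set.range ι} → Space)) {T : Set (Config N)}
    (hT : T = {X | (∀ i, X (ι i) - z ∈ box ℓ) ∧ (fun j : {j // j ∉ Set.range ι} => X j) ∈ A}) :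
    ENNReal.ofReal (boxGroundStateEnergy κ g ρ θ ν n ℓ + g * ρ * (n * (M * (M * ∫ y, yukawa ν y)))) *
          (∫⁻ X in T, (‖ψ X‖₊ : ℝ≥0∞) ^ 2) +
        ENNReal.ofReal (g * ρ) *
          (∫⁻ X in T, ENNReal.ofReal (boxOneBody θ ν fun i => X (ι i) - z) * (‖ψ X‖₊ : ℝ≥0∞) ^ 2) ≤
      ENNReal.ofReal κ * (∫⁻ X in T, kineticOn ι ψ X) +
        ENNReal.ofReal g *
          (∫⁻ X in T, ENNReal.ofReal (boxPair θ ν fun i => X (ι i) - z) * (‖ψ X‖₊ : ℝ≥0∞) ^ 2) +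
        ENNReal.ofReal (g * ρ ^ 2 * boxBackgroundSelfEnergy θ ν +
            g * ρ * (n * (M * (M * ∫ y, yukawa ν y)))) * (∫⁻ X in T, (‖ψ X‖₊ : ℝ≥0∞) ^ 2) := by
  -- constants
  set E : ℝ := boxGroundStateEnergy κ g ρ θ ν n ℓ with hE
  set c₀ : ℝ := g * ρ * (n * (M * (M * ∫ y, yukawa ν y))) with hc₀
  set bb : ℝ := boxBackgroundSelfEnergy θ ν with hbb
  have hM0 : 0 ≤ M := (hθ 0).trans (hM 0)
  have hIY : 0 ≤ ∫ y, yukawa ν y := integral_nonneg fun y => yukawa_nonneg ν y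
  have hc₀0 : 0 ≤ c₀ := by positivity
  have hEc : 0 ≤ E + c₀ := by
    have := boxGroundStateEnergy_ge (κ := κ) hκ hg hρ hθ hM hν hℓ (n := n)
    linarith
  have hbb0 : 0 ≤ bb := mul_nonneg (by norm_num) (integral_nonneg fun x =>
    mul_nonneg (hθ x) (smearedBackground_nonneg hθ ν x))
  -- the gluing change of variables
  set G := glueEquiv ι z with hG
  have hGmp := volume_preserving_glueEquiv ι z
  have hpre : G ⁻¹' T = boxN n ℓ ×ˢ A := by
    ext ⟨Y, Z⟩
    have hZ : (fun j : {j // j ∉ Set.range ι} => glueEquiv ι z (Y, Z) j) = Z :=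
      funext fun j => glueEquiv_apply_of_not_mem ι z Y Z j j.2
    simp only [hT, hG, Set.mem_preimage, Set.mem_setOf_eq, glueEquiv_apply_ι,
      add_sub_cancel_left, hZ, Set.mem_prod, boxN]
  have hcv : ∀ F : Config N → ℝ≥0∞,
      ∫⁻ X in T, F X = ∫⁻ p in boxN n ℓ ×ˢ A, F (G p) ∂(volume.prod volume) := by
    intro F
    rw [← hpre, ← Measure.volume_eq_prod]
    exact (hGmp.setLIntegral_comp_preimage_emb G.measurableEmbedding F T).symm
  -- the group coordinates of a glued configuration
  have hgrp : ∀ (Y : Config n) (Z : {j // j ∉ Set.range ι} → Space),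
      (fun i => G (Y, Z) (ι i) - z) = Y := fun Y Z => by
    funext i; simp [hG, glueEquiv_apply_ι]
  -- measurability of the integrands
  have hproj : Measurable fun X : Config N => (fun i => X (ι i) - z : Config n) :=
    measurable_pi_lambda _ fun i => (measurable_config_apply (ι i)).sub_const z
  have hn2 : Measurable fun X : Config N => (‖ψ X‖₊ : ℝ≥0∞) ^ 2 := measurable_normSq hψ.continuous
  have hKm : Measurable fun X : Config N => kineticOn ι ψ X := measurable_kineticOn ι hψ
  have hPm : Measurable fun X : Config N =>
      ENNReal.ofReal (boxPair θ ν fun i => X (ι i) - z) * (‖ψ X‖₊ : ℝ≥0∞) ^ 2 :=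
    ((measurable_boxPair hθm ν).comp hproj).ennreal_ofReal.mul hn2
  have hBm : Measurable fun X : Config N =>
      ENNReal.ofReal (boxOneBody θ ν fun i => X (ι i) - z) * (‖ψ X‖₊ : ℝ≥0∞) ^ 2 :=
    ((measurable_boxOneBody hθm ν).comp hproj).ennreal_ofReal.mul hn2
  -- pass to iterated integrals over `Z ∈ A` (outer) and `Y ∈ Λ^n` (inner)
  rw [hcv (fun X => (‖ψ X‖₊ : ℝ≥0∞) ^ 2), hcv (fun X => kineticOn ι ψ X),
    hcv (fun X => ENNReal.ofReal (boxPair θ ν fun i => X (ι i) - z) * (‖ψ X‖₊ : ℝ≥0∞) ^ 2),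
    hcv (fun X => ENNReal.ofReal (boxOneBody θ ν fun i => X (ι i) - z) * (‖ψ X‖₊ : ℝ≥0∞) ^ 2),
    setLIntegral_prod_symm (fun p => (‖ψ (G p)‖₊ : ℝ≥0∞) ^ 2) (hn2.comp G.measurable).aemeasurable,
    setLIntegral_prod_symm (fun p => kineticOn ι ψ (G p)) (hKm.comp G.measurable).aemeasurable,
    setLIntegral_prod_symm (fun p => ENNReal.ofReal (boxPair θ ν fun i => G p (ι i) - z) *
      (‖ψ (G p)‖₊ : ℝ≥0∞) ^ 2) (hPm.comp G.measurable).aemeasurable,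
    setLIntegral_prod_symm (fun p => ENNReal.ofReal (boxOneBody θ ν fun i => G p (ι i) - z) *
      (‖ψ (G p)‖₊ : ℝ≥0∞) ^ 2) (hBm.comp G.measurable).aemeasurable]
  -- measurability in `Z` of the inner integrals
  have hmZ : ∀ {F : Config N → ℝ≥0∞}, Measurable F →
      Measurable fun Z : {j // j ∉ Set.range ι} → Space => ∫⁻ Y in boxN n ℓ, F (G (Y, Z)) :=
    fun {F} hF => (hF.comp G.measurable).lintegral_prod_left'
  have hm1 : Measurable fun Z : {j // j ∉ Set.range ι} → Space =>
      ENNReal.ofReal (E + c₀) * ∫⁻ Y in boxN n ℓ, (‖ψ (G (Y, Z))‖₊ : ℝ≥0∞) ^ 2 :=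
    (hmZ hn2).const_mul _
  have hm2 : Measurable fun Z : {j // j ∉ Set.range ι} → Space =>
      ENNReal.ofReal κ * ∫⁻ Y in boxN n ℓ, kineticOn ι ψ (G (Y, Z)) :=
    (hmZ hKm).const_mul _
  have hm3 : Measurable fun Z : {j // j ∉ Set.range ι} → Space =>
      ENNReal.ofReal κ * (∫⁻ Y in boxN n ℓ, kineticOn ι ψ (G (Y, Z))) +
        ENNReal.ofReal g * ∫⁻ Y in boxN n ℓ,
          ENNReal.ofReal (boxPair θ ν fun i => G (Y, Z) (ι i) - z) * (‖ψ (G (Y, Z))‖₊ : ℝ≥0∞) ^ 2 :=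
    hm2.add ((hmZ hPm).const_mul _)
  -- rewrite both sides as single integrals over `Z`
  rw [← lintegral_const_mul' _ _ ENNReal.ofReal_ne_top, ← lintegral_const_mul' _ _ ENNReal.ofReal_ne_top,
    ← lintegral_const_mul' _ _ ENNReal.ofReal_ne_top, ← lintegral_const_mul' _ _ ENNReal.ofReal_ne_top,
    ← lintegral_const_mul' _ _ ENNReal.ofReal_ne_top,
    ← lintegral_add_left hm1, ← lintegral_add_left hm2, ← lintegral_add_left hm3]
  refine lintegral_mono fun Z => ?_
  -- the slice at the frozen configuration `Z`
  have hφ : ContDiff ℝ 1 (slice ι z ψ Z) := contDiff_slice ι z hψ Z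
  have hφs : IsBoseSymmetric (slice ι z ψ Z) := isBoseSymmetric_slice ι z hsymm Z
  have key := boxGroundStateEnergy_mul_le (ℓ := ℓ) hκ hg hρ hθ hM hν hφ hφs
  -- identify the slice functionals
  have e1 : ∀ Y, (‖ψ (G (Y, Z))‖₊ : ℝ≥0∞) ^ 2 = (‖slice ι z ψ Z Y‖₊ : ℝ≥0∞) ^ 2 := fun Y => rfl
  have e2 : ∀ Y, kineticOn ι ψ (G (Y, Z)) = kineticDensity (slice ι z ψ Z) Y := fun Y =>
    (kineticDensity_slice ι z hψ Z Y).symm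
  simp only [e1, e2, hgrp]
  -- finiteness of the slice functionals
  set mS := ∫⁻ Y in boxN n ℓ, (‖slice ι z ψ Z Y‖₊ : ℝ≥0∞) ^ 2 with hmS
  set TS := ∫⁻ Y in boxN n ℓ, kineticDensity (slice ι z ψ Z) Y with hTS
  set PS := ∫⁻ Y in boxN n ℓ, ENNReal.ofReal (boxPair θ ν Y) * (‖slice ι z ψ Z Y‖₊ : ℝ≥0∞) ^ 2
    with hPS
  set BS := ∫⁻ Y in boxN n ℓ, ENNReal.ofReal (boxOneBody θ ν Y) * (‖slice ι z ψ Z Y‖₊ : ℝ≥0∞) ^ 2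
    with hBS
  have hmS_top : mS ≠ ⊤ := (lintegral_boxN_normSq_lt_top hφ.continuous ℓ).ne
  have hTS_top : TS ≠ ⊤ := setLIntegral_boxN_kineticDensity_ne_top hφ ℓ
  obtain ⟨B, hBbd⟩ := exists_bound_on_boxN hφ.continuous ℓ
  have hPS_top : PS ≠ ⊤ := setLIntegral_boxPair_mul_normSq_ne_top hθ hM hν.le hBbd
  have hBS_le : BS ≤ ENNReal.ofReal (n * (M * (M * ∫ y, yukawa ν y))) * mS :=
    setLIntegral_boxOneBody_mul_normSq_le hθ hM hν _
  have hBS_top : BS ≠ ⊤ :=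
    ne_top_of_le_ne_top (ENNReal.mul_ne_top ENNReal.ofReal_ne_top hmS_top) hBS_le
  -- the real inequality for the slice, rearranged with nonnegative terms
  have hm0 : 0 ≤ mS.toReal := ENNReal.toReal_nonneg
  have hT0 : 0 ≤ TS.toReal := ENNReal.toReal_nonneg
  have hP0 : 0 ≤ PS.toReal := ENNReal.toReal_nonneg
  have hB0 : 0 ≤ BS.toReal := ENNReal.toReal_nonneg
  have hreal : (E + c₀) * mS.toReal + g * ρ * BS.toReal ≤
      κ * TS.toReal + g * PS.toReal + (g * ρ ^ 2 * bb + c₀) * mS.toReal := by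
    have k := key
    nlinarith [k, mul_nonneg hc₀0 hm0]
  -- back to `ℝ≥0∞`
  have hL : ENNReal.ofReal (E + c₀) * mS + ENNReal.ofReal (g * ρ) * BS =
      ENNReal.ofReal ((E + c₀) * mS.toReal + g * ρ * BS.toReal) := by
    rw [ENNReal.ofReal_add (mul_nonneg hEc hm0) (mul_nonneg (mul_nonneg hg hρ) hB0),
      ENNReal.ofReal_mul hEc, ENNReal.ofReal_mul (mul_nonneg hg hρ),
      ENNReal.ofReal_toReal hmS_top, ENNReal.ofReal_toReal hBS_top]
  have hR : ENNReal.ofReal κ * TS + ENNReal.ofReal g * PS + ENNReal.ofReal (g * ρ ^ 2 * bb + c₀) * mS =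
      ENNReal.ofReal (κ * TS.toReal + g * PS.toReal + (g * ρ ^ 2 * bb + c₀) * mS.toReal) := by
    have h3 : 0 ≤ g * ρ ^ 2 * bb + c₀ := by positivity
    rw [ENNReal.ofReal_add (add_nonneg (mul_nonneg hκ hT0) (mul_nonneg hg hP0)) (mul_nonneg h3 hm0),
      ENNReal.ofReal_add (mul_nonneg hκ hT0) (mul_nonneg hg hP0),
      ENNReal.ofReal_mul hκ, ENNReal.ofReal_mul hg, ENNReal.ofReal_mul h3,
      ENNReal.ofReal_toReal hTS_top, ENNReal.ofReal_toReal hPS_top, ENNReal.ofReal_toReal hmS_top]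
  rw [hL, hR]
  exact ENNReal.ofReal_le_ofReal hreal

end Group

/-! ### Bookkeeping: from `ℝ≥0∞` to `ℝ` -/

/-- Real form of an `ℝ≥0∞` inequality `aμ + bB ≤ cK + dP + eμ` with finite `μ, B, K, P` and
nonnegative real scalars. [folklore] -/
theorem toReal_of_ofReal_mul_le {a b c d e : ℝ} (ha : 0 ≤ a) (hb : 0 ≤ b) (hc : 0 ≤ c) (hd : 0 ≤ d)
    (he : 0 ≤ e) {μ B K P : ℝ≥0∞} (hμ : μ ≠ ⊤) (hB : B ≠ ⊤) (hK : K ≠ ⊤) (hP : P ≠ ⊤)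
    (h : ENNReal.ofReal a * μ + ENNReal.ofReal b * B ≤
      ENNReal.ofReal c * K + ENNReal.ofReal d * P + ENNReal.ofReal e * μ) :
    a * μ.toReal + b * B.toReal ≤ c * K.toReal + d * P.toReal + e * μ.toReal := by
  have h1 : ENNReal.ofReal a * μ ≠ ⊤ := ENNReal.mul_ne_top ENNReal.ofReal_ne_top hμ
  have h2 : ENNReal.ofReal b * B ≠ ⊤ := ENNReal.mul_ne_top ENNReal.ofReal_ne_top hB
  have h3 : ENNReal.ofReal c * K ≠ ⊤ := ENNReal.mul_ne_top ENNReal.ofReal_ne_top hK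
  have h4 : ENNReal.ofReal d * P ≠ ⊤ := ENNReal.mul_ne_top ENNReal.ofReal_ne_top hP
  have h5 : ENNReal.ofReal e * μ ≠ ⊤ := ENNReal.mul_ne_top ENNReal.ofReal_ne_top hμ
  have hr := (ENNReal.toReal_le_toReal (ENNReal.add_ne_top.2 ⟨h1, h2⟩)
    (ENNReal.add_ne_top.2 ⟨ENNReal.add_ne_top.2 ⟨h3, h4⟩, h5⟩)).2 h
  rw [ENNReal.toReal_add h1 h2, ENNReal.toReal_add (ENNReal.add_ne_top.2 ⟨h3, h4⟩) h5,
    ENNReal.toReal_add h3 h4, ENNReal.toReal_mul, ENNReal.toReal_mul, ENNReal.toReal_mul,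
    ENNReal.toReal_mul, ENNReal.toReal_mul, ENNReal.toReal_ofReal ha, ENNReal.toReal_ofReal hb,
    ENNReal.toReal_ofReal hc, ENNReal.toReal_ofReal hd, ENNReal.toReal_ofReal he] at hr
  exact hr

/-! ### The partition of configuration space by the set of particles in the box -/

section Partition

variable {N : ℕ}

/-- The piece `T_S(z) = {X | xⱼ ∈ z + Λ_ℓ ⟺ j ∈ S}` is measurable. [folklore] -/
theorem measurableSet_pieceSet (ℓ : ℝ) (z : Space) (S : Finset (Fin N)) :
    MeasurableSet {X : Config N | ∀ j, X j - z ∈ box ℓ ↔ j ∈ S} := by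
  have h : {X : Config N | ∀ j, X j - z ∈ box ℓ ↔ j ∈ S} = ⋂ j, {X : Config N | X j - z ∈ box ℓ ↔ j ∈ S} := by
    ext X; simp only [Set.mem_setOf_eq, Set.mem_iInter]
  rw [h]
  refine MeasurableSet.iInter fun j => ?_
  have hm : MeasurableSet {X : Config N | X j - z ∈ box ℓ} :=
    ((measurable_config_apply j).sub_const z) (measurableSet_box ℓ)
  by_cases hj : j ∈ S
  · simp only [hj, iff_true]; exact hm
  · simp only [hj, iff_false]; exact hm.compl

/-- **The pieces partition configuration space**: `∑_S ∫_{T_S(z)} F = ∫ F` for measurable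
`F ≥ 0`. [cite: LiebSolovej2001, Lemma 3.2 (proof)] -/
theorem sum_setLIntegral_pieceSet (ℓ : ℝ) (z : Space) {F : Config N → ℝ≥0∞} (hF : Measurable F) :
    ∑ S : Finset (Fin N), ∫⁻ X in {X : Config N | ∀ j, X j - z ∈ box ℓ ↔ j ∈ S}, F X = ∫⁻ X, F X := by
  classical
  have hpt : ∀ X : Config N, ∑ S : Finset (Fin N), ({X : Config N | ∀ j, X j - z ∈ box ℓ ↔ j ∈ S}).indicator F X = F X := by
    intro X
    set SX : Finset (Fin N) := Finset.univ.filter fun j => X j - z ∈ box ℓ with hSX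
    have hmem : X ∈ {X : Config N | ∀ j, X j - z ∈ box ℓ ↔ j ∈ SX} :=
      show ∀ j, X j - z ∈ box ℓ ↔ j ∈ SX from fun j => by simp [hSX]
    rw [Finset.sum_eq_single_of_mem SX (Finset.mem_univ _) fun S _ hS => ?_]
    · exact indicator_of_mem hmem F
    · refine indicator_of_notMem (fun hX => hS ?_) F
      ext j
      simp only [Set.mem_setOf_eq] at hX
      rw [← hX j, hSX, Finset.mem_filter]
      simp
  calc ∑ S : Finset (Fin N), ∫⁻ X in {X : Config N | ∀ j, X j - z ∈ box ℓ ↔ j ∈ S}, F X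
      = ∑ S : Finset (Fin N), ∫⁻ X, ({X : Config N | ∀ j, X j - z ∈ box ℓ ↔ j ∈ S}).indicator F X :=
        Finset.sum_congr rfl fun S _ => (lintegral_indicator (measurableSet_pieceSet ℓ z S) _).symm
    _ = ∫⁻ X, ∑ S : Finset (Fin N), ({X : Config N | ∀ j, X j - z ∈ box ℓ ↔ j ∈ S}).indicator F X :=
        (lintegral_finsetSum _ fun S _ => hF.indicator (measurableSet_pieceSet ℓ z S)).symm
    _ = ∫⁻ X, F X := lintegral_congr hpt

/-- A piece in group-extraction form: with `ι` an embedding of range `S`,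
`T_S(z) = {X | (∀ i, x_{ι i} - z ∈ Λ_ℓ) ∧ (∀ j ∉ range ι, xⱼ - z ∉ Λ_ℓ)}`. [folklore] -/
theorem pieceSet_eq_groupSet {n : ℕ} (ι : Fin n ↪ Fin N) {S : Finset (Fin N)}
    (hS : Set.range ι = (S : Set (Fin N))) (ℓ : ℝ) (z : Space) :
    {X : Config N | ∀ j, X j - z ∈ box ℓ ↔ j ∈ S} = {X : Config N | (∀ i, X (ι i) - z ∈ box ℓ) ∧
      (fun j : {j // j ∉ Set.range ι} => X j) ∈
        {Z : {j // j ∉ Set.range ι} → Space | ∀ j, Z j - z ∉ box ℓ}} := by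
  have hmemS : ∀ j : Fin N, j ∈ S ↔ j ∈ Set.range ι := fun j => by
    rw [← Finset.mem_coe, ← hS]
  ext X
  simp only [Set.mem_setOf_eq]
  constructor
  · intro hX
    refine ⟨fun i => (hX (ι i)).2 ((hmemS _).2 ⟨i, rfl⟩), fun j => ?_⟩
    exact fun hj => j.2 ((hmemS _).1 ((hX j).1 hj))
  · rintro ⟨h1, h2⟩ j
    constructor
    · intro hj
      by_contra hjS
      exact h2 ⟨j, fun hr => hjS ((hmemS j).2 hr)⟩ hj
    · intro hjS
      obtain ⟨i, rfl⟩ := (hmemS j).1 hjS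
      exact h1 i

end Partition

/-! ### The decomposition step of Lemma 3.2 -/

section Decomposition

variable {N : ℕ}

/-- **[LiebSolovej2001, Lemma 3.2], the decomposition step** ("it is clear that
`(Ψ, H̃_{μ,λ} Ψ) ≥ inf_{1≤n≤N} E^n_{μ,λ}`", made quantitative): let `θ` be measurable with
`0 ≤ θ ≤ M` and `θ = 0` off the box `Λ_ℓ`, `ν > 0`, `κ, g, ρ ≥ 0`, `ℓ > 0`, and let `Ψ` be a
Bose-symmetric `C¹` function on `(ℝ³)^N` with finite mass, kinetic energy and localized pair
energy. For the box `Q_z = z + Λ_ℓ` write `T_S(z) = {X | xⱼ ∈ Q_z ⟺ j ∈ S}` (`S ⊆ {1..N}`) and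
`E^n = boxGroundStateEnergy κ g ρ θ ν n ℓ`. Then
`∑_S E^{|S|} ∫_{T_S(z)}|Ψ|² ≤ κ ∑ⱼ∫𝟙_{Q_z}(xⱼ)|∇ⱼΨ|² + g (∫PP_z|Ψ|² - ρ∫PB_z|Ψ|²) + gρ²(½∬w)∫|Ψ|²`,
with `PP_z(X) = ∑_{i<j} θ(xᵢ-z)Y_ν(xᵢ-xⱼ)θ(xⱼ-z)` and `PB_z(X) = ∑ⱼ θ(xⱼ-z)U(xⱼ-z)` (full
smeared background) — the right side is `(Ψ, H̃_z Ψ)`; since `∑_S ∫_{T_S}|Ψ|² = ∫|Ψ|²`, the left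
side is `≥ (min_{n ≤ N} E^n) ∫|Ψ|²`. [cite: LiebSolovej2001, Lemma 3.2] -/
theorem sum_boxGroundStateEnergy_mul_mass_le {κ g ρ : ℝ} (hκ : 0 ≤ κ) (hg : 0 ≤ g) (hρ : 0 ≤ ρ)
    {θ : Space → ℝ} (hθm : Measurable θ) (hθ : ∀ x, 0 ≤ θ x) {M : ℝ} (hM : ∀ x, θ x ≤ M)
    {ν : ℝ} (hν : 0 < ν) {ℓ : ℝ} (hℓ : 0 < ℓ) (hθ0 : ∀ x, x ∉ box ℓ → θ x = 0) (z : Space)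
    {ψ : Config N → ℂ} (hψ : ContDiff ℝ 1 ψ) (hsymm : IsBoseSymmetric ψ)
    (hmass : ∫⁻ X, (‖ψ X‖₊ : ℝ≥0∞) ^ 2 ≠ ⊤) (hkin : ∫⁻ X, kineticDensity ψ X ≠ ⊤)
    (hPP : ∫⁻ X, ENNReal.ofReal (∑ i, ∑ j with i < j, θ (X i - z) * yukawa ν (X i - X j) * θ (X j - z)) * (‖ψ X‖₊ : ℝ≥0∞) ^ 2 ≠ ⊤) :
    ∑ S : Finset (Fin N), boxGroundStateEnergy κ g ρ θ ν S.card ℓ *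
        (∫⁻ X in {X : Config N | ∀ j, X j - z ∈ box ℓ ↔ j ∈ S}, (‖ψ X‖₊ : ℝ≥0∞) ^ 2).toReal ≤
      κ * (∫⁻ X, ∑ j, (box ℓ).indicator (fun _ => (1 : ℝ≥0∞)) (X j - z) *
            ∑ k : Fin 3, (‖fderiv ℝ ψ X (Pi.single j (EuclideanSpace.single k (1 : ℝ)))‖₊ : ℝ≥0∞) ^ 2).toReal +
        g * ((∫⁻ X, ENNReal.ofReal (∑ i, ∑ j with i < j, θ (X i - z) * yukawa ν (X i - X j) * θ (X j - z)) * (‖ψ X‖₊ : ℝ≥0∞) ^ 2).toReal -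
          ρ * (∫⁻ X, ENNReal.ofReal (∑ j, θ (X j - z) * smearedBackground θ ν (X j - z)) * (‖ψ X‖₊ : ℝ≥0∞) ^ 2).toReal) +
        g * ρ ^ 2 * boxBackgroundSelfEnergy θ ν * (∫⁻ X, (‖ψ X‖₊ : ℝ≥0∞) ^ 2).toReal := by
  classical
  have hM0 : 0 ≤ M := (hθ 0).trans (hM 0)
  have hIY : 0 ≤ ∫ y, yukawa ν y := integral_nonneg fun y => yukawa_nonneg ν y
  have hbb0 : 0 ≤ boxBackgroundSelfEnergy θ ν := mul_nonneg (by norm_num) (integral_nonneg fun x =>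
    mul_nonneg (hθ x) (smearedBackground_nonneg hθ ν x))
  -- `θ(x - z) = 0` unless `x - z ∈ Λ_ℓ`
  have hθz : ∀ x : Space, x - z ∉ box ℓ → θ (x - z) = 0 := fun x hx => hθ0 _ hx
  -- measurability of the global integrands
  have hW : Measurable fun X : Config N => (‖ψ X‖₊ : ℝ≥0∞) ^ 2 := measurable_normSq hψ.continuous
  have hKj : ∀ j : Fin N, Measurable fun X : Config N =>
      ∑ k : Fin 3, (‖fderiv ℝ ψ X (Pi.single j (EuclideanSpace.single k (1 : ℝ)))‖₊ : ℝ≥0∞) ^ 2 :=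
    measurable_kineticDensityAt hψ
  have hind : ∀ j : Fin N, Measurable fun X : Config N =>
      (box ℓ).indicator (fun _ => (1 : ℝ≥0∞)) (X j - z) := fun j =>
    (measurable_const.indicator (measurableSet_box ℓ)).comp ((measurable_config_apply j).sub_const z)
  have hKIN : Measurable fun X : Config N => ∑ j, (box ℓ).indicator (fun _ => (1 : ℝ≥0∞)) (X j - z) *
            ∑ k : Fin 3, (‖fderiv ℝ ψ X (Pi.single j (EuclideanSpace.single k (1 : ℝ)))‖₊ : ℝ≥0∞) ^ 2 :=
    Finset.measurable_sum _ fun j _ => (hind j).mul (hKj j)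
  have hsubz : ∀ j : Fin N, Measurable fun X : Config N => X j - z := fun j =>
    (measurable_config_apply j).sub_const z
  have hPPm : Measurable fun X : Config N => ENNReal.ofReal (∑ i, ∑ j with i < j, θ (X i - z) * yukawa ν (X i - X j) * θ (X j - z)) * (‖ψ X‖₊ : ℝ≥0∞) ^ 2 := by
    refine (Finset.measurable_sum _ fun i _ => Finset.measurable_sum _ fun j _ => ?_).ennreal_ofReal.mul hW
    exact ((hθm.comp (hsubz i)).mul ((measurable_yukawa ν).comp
      ((measurable_config_apply i).sub (measurable_config_apply j)))).mul (hθm.comp (hsubz j))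
  have hPBm : Measurable fun X : Config N => ENNReal.ofReal (∑ j, θ (X j - z) * smearedBackground θ ν (X j - z)) * (‖ψ X‖₊ : ℝ≥0∞) ^ 2 :=
    (Finset.measurable_sum _ fun j _ => (hθm.comp (hsubz j)).mul
      ((measurable_smearedBackground hθm ν).comp (hsubz j))).ennreal_ofReal.mul hW
  -- global finiteness
  have hKINle : ∫⁻ X, ∑ j, (box ℓ).indicator (fun _ => (1 : ℝ≥0∞)) (X j - z) *
            ∑ k : Fin 3, (‖fderiv ℝ ψ X (Pi.single j (EuclideanSpace.single k (1 : ℝ)))‖₊ : ℝ≥0∞) ^ 2 ≤ ∫⁻ X, kineticDensity ψ X := by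
    refine lintegral_mono fun X => ?_
    unfold kineticDensity
    refine Finset.sum_le_sum fun j _ => ?_
    calc (box ℓ).indicator (fun _ => (1 : ℝ≥0∞)) (X j - z) *
          ∑ k : Fin 3, (‖fderiv ℝ ψ X (Pi.single j (EuclideanSpace.single k (1 : ℝ)))‖₊ : ℝ≥0∞) ^ 2
        ≤ 1 * ∑ k : Fin 3, (‖fderiv ℝ ψ X (Pi.single j (EuclideanSpace.single k (1 : ℝ)))‖₊ : ℝ≥0∞) ^ 2 :=
          mul_le_mul' (Set.indicator_le_self' (fun _ _ => zero_le_one) _) le_rfl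
      _ = _ := one_mul _
  have hKINtop : ∫⁻ X, ∑ j, (box ℓ).indicator (fun _ => (1 : ℝ≥0∞)) (X j - z) *
            ∑ k : Fin 3, (‖fderiv ℝ ψ X (Pi.single j (EuclideanSpace.single k (1 : ℝ)))‖₊ : ℝ≥0∞) ^ 2 ≠ ⊤ := ne_top_of_le_ne_top hkin hKINle
  have hPBpt : ∀ X : Config N, ∑ j, θ (X j - z) * smearedBackground θ ν (X j - z) ≤
      N * (M * (M * ∫ y, yukawa ν y)) := fun X =>
    boxOneBody_le hθ hM hν (fun j => X j - z)
  have hPBle : ∫⁻ X, ENNReal.ofReal (∑ j, θ (X j - z) * smearedBackground θ ν (X j - z)) *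
      (‖ψ X‖₊ : ℝ≥0∞) ^ 2 ≤ ENNReal.ofReal (N * (M * (M * ∫ y, yukawa ν y))) * ∫⁻ X, (‖ψ X‖₊ : ℝ≥0∞) ^ 2 := by
    rw [← lintegral_const_mul' _ _ ENNReal.ofReal_ne_top]
    exact lintegral_mono fun X => mul_le_mul' (ENNReal.ofReal_le_ofReal (hPBpt X)) le_rfl
  have hPBtop : ∫⁻ X, ENNReal.ofReal (∑ j, θ (X j - z) * smearedBackground θ ν (X j - z)) * (‖ψ X‖₊ : ℝ≥0∞) ^ 2 ≠ ⊤ :=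
    ne_top_of_le_ne_top (ENNReal.mul_ne_top ENNReal.ofReal_ne_top hmass) hPBle
  -- the per-piece inequality
  have hS : ∀ S : Finset (Fin N),
      boxGroundStateEnergy κ g ρ θ ν S.card ℓ * (∫⁻ X in {X : Config N | ∀ j, X j - z ∈ box ℓ ↔ j ∈ S}, (‖ψ X‖₊ : ℝ≥0∞) ^ 2).toReal +
          g * ρ * (∫⁻ X in {X : Config N | ∀ j, X j - z ∈ box ℓ ↔ j ∈ S}, ENNReal.ofReal (∑ j, θ (X j - z) * smearedBackground θ ν (X j - z)) * (‖ψ X‖₊ : ℝ≥0∞) ^ 2).toReal ≤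
        κ * (∫⁻ X in {X : Config N | ∀ j, X j - z ∈ box ℓ ↔ j ∈ S}, ∑ j, (box ℓ).indicator (fun _ => (1 : ℝ≥0∞)) (X j - z) *
            ∑ k : Fin 3, (‖fderiv ℝ ψ X (Pi.single j (EuclideanSpace.single k (1 : ℝ)))‖₊ : ℝ≥0∞) ^ 2).toReal +
          g * (∫⁻ X in {X : Config N | ∀ j, X j - z ∈ box ℓ ↔ j ∈ S}, ENNReal.ofReal (∑ i, ∑ j with i < j, θ (X i - z) * yukawa ν (X i - X j) * θ (X j - z)) * (‖ψ X‖₊ : ℝ≥0∞) ^ 2).toReal +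
          g * ρ ^ 2 * boxBackgroundSelfEnergy θ ν *
            (∫⁻ X in {X : Config N | ∀ j, X j - z ∈ box ℓ ↔ j ∈ S}, (‖ψ X‖₊ : ℝ≥0∞) ^ 2).toReal := by
    intro S
    set n := S.card with hn
    set ι : Fin n ↪o Fin N := S.orderEmbOfFin rfl with hι
    have hrange : Set.range ι = (S : Set (Fin N)) := Finset.range_orderEmbOfFin S rfl
    have hrange' : Set.range ι.toEmbedding = (S : Set (Fin N)) := hrange
    have hTS := pieceSet_eq_groupSet ι.toEmbedding hrange' ℓ z
    have hmS := measurableSet_pieceSet ℓ z S (N := N)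
    -- the group-extraction inequality on this piece
    have hGE := box_group_extraction hκ hg hρ hθm hθ hM hν hℓ ι.toEmbedding z hψ hsymm
      {Z : {j // j ∉ Set.range ι.toEmbedding} → Space | ∀ j, Z j - z ∉ box ℓ} hTS
    -- identify the integrands on the piece
    have hmem : ∀ X : Config N, X ∈ {X : Config N | ∀ j, X j - z ∈ box ℓ ↔ j ∈ S} → ∀ j, (X j - z ∈ box ℓ ↔ j ∈ S) := fun X hX => hX
    have eK : ∀ X ∈ {X : Config N | ∀ j, X j - z ∈ box ℓ ↔ j ∈ S}, kineticOn ι.toEmbedding ψ X = ∑ j, (box ℓ).indicator (fun _ => (1 : ℝ≥0∞)) (X j - z) *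
            ∑ k : Fin 3, (‖fderiv ℝ ψ X (Pi.single j (EuclideanSpace.single k (1 : ℝ)))‖₊ : ℝ≥0∞) ^ 2 := by
      intro X hX
      unfold kineticOn
      rw [sum_orderEmb_eq_sum_ite ι.toEmbedding hrange' (fun j => ∑ k : Fin 3,
        (‖fderiv ℝ ψ X (Pi.single j (EuclideanSpace.single k (1 : ℝ)))‖₊ : ℝ≥0∞) ^ 2)]
      refine Finset.sum_congr rfl fun j _ => ?_
      by_cases hj : j ∈ S
      · rw [if_pos hj, indicator_of_mem ((hmem X hX j).2 hj), one_mul]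
      · rw [if_neg hj, indicator_of_notMem (fun h => hj ((hmem X hX j).1 h)), zero_mul]
    have eP : ∀ X ∈ {X : Config N | ∀ j, X j - z ∈ box ℓ ↔ j ∈ S}, boxPair θ ν (fun i => X (ι.toEmbedding i) - z) = ∑ i, ∑ j with i < j, θ (X i - z) * yukawa ν (X i - X j) * θ (X j - z) := by
      intro X hX
      unfold boxPair
      rw [sum_pairs_orderEmb ι hrange (fun i j => θ (X i - z) * yukawa ν (X i - X j) * θ (X j - z))
        (fun i j hij => ?_)]
      · refine Finset.sum_congr rfl fun a _ => Finset.sum_congr rfl fun b _ => ?_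
        simp only [RelEmbedding.coe_toEmbedding, sub_sub_sub_cancel_right]
      · rcases hij with hi | hj'
        · rw [hθz _ (fun h => hi ((hmem X hX i).1 h)), zero_mul, zero_mul]
        · rw [hθz _ (fun h => hj' ((hmem X hX j).1 h)), mul_zero]
    have eB : ∀ X ∈ {X : Config N | ∀ j, X j - z ∈ box ℓ ↔ j ∈ S}, boxOneBody θ ν (fun i => X (ι.toEmbedding i) - z) = ∑ j, θ (X j - z) * smearedBackground θ ν (X j - z) := by
      intro X hX
      unfold boxOneBody
      rw [sum_orderEmb_eq_sum_ite ι.toEmbedding hrange'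
        (fun j => θ (X j - z) * smearedBackground θ ν (X j - z))]
      refine Finset.sum_congr rfl fun j _ => ?_
      by_cases hj : j ∈ S
      · rw [if_pos hj]
      · rw [if_neg hj, hθz _ (fun h => hj ((hmem X hX j).1 h)), zero_mul]
    rw [setLIntegral_congr_fun hmS eK,
      setLIntegral_congr_fun hmS (fun X hX => by rw [eP X hX] :
        ∀ X ∈ {X : Config N | ∀ j, X j - z ∈ box ℓ ↔ j ∈ S}, ENNReal.ofReal (boxPair θ ν fun i => X (ι.toEmbedding i) - z) * (‖ψ X‖₊ : ℝ≥0∞) ^ 2 =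
          ENNReal.ofReal (∑ i, ∑ j with i < j, θ (X i - z) * yukawa ν (X i - X j) * θ (X j - z)) * (‖ψ X‖₊ : ℝ≥0∞) ^ 2),
      setLIntegral_congr_fun hmS (fun X hX => by rw [eB X hX] :
        ∀ X ∈ {X : Config N | ∀ j, X j - z ∈ box ℓ ↔ j ∈ S}, ENNReal.ofReal (boxOneBody θ ν fun i => X (ι.toEmbedding i) - z) * (‖ψ X‖₊ : ℝ≥0∞) ^ 2 =
          ENNReal.ofReal (∑ j, θ (X j - z) * smearedBackground θ ν (X j - z)) * (‖ψ X‖₊ : ℝ≥0∞) ^ 2)] at hGE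
    -- finiteness on the piece and passage to reals
    have hμ : ∫⁻ X in {X : Config N | ∀ j, X j - z ∈ box ℓ ↔ j ∈ S}, (‖ψ X‖₊ : ℝ≥0∞) ^ 2 ≠ ⊤ := ne_top_of_le_ne_top hmass (setLIntegral_le_lintegral _ _)
    have hB' : ∫⁻ X in {X : Config N | ∀ j, X j - z ∈ box ℓ ↔ j ∈ S}, ENNReal.ofReal (∑ j, θ (X j - z) * smearedBackground θ ν (X j - z)) * (‖ψ X‖₊ : ℝ≥0∞) ^ 2 ≠ ⊤ :=
      ne_top_of_le_ne_top hPBtop (setLIntegral_le_lintegral _ _)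
    have hK' : ∫⁻ X in {X : Config N | ∀ j, X j - z ∈ box ℓ ↔ j ∈ S}, ∑ j, (box ℓ).indicator (fun _ => (1 : ℝ≥0∞)) (X j - z) *
            ∑ k : Fin 3, (‖fderiv ℝ ψ X (Pi.single j (EuclideanSpace.single k (1 : ℝ)))‖₊ : ℝ≥0∞) ^ 2 ≠ ⊤ := ne_top_of_le_ne_top hKINtop (setLIntegral_le_lintegral _ _)
    have hP' : ∫⁻ X in {X : Config N | ∀ j, X j - z ∈ box ℓ ↔ j ∈ S}, ENNReal.ofReal (∑ i, ∑ j with i < j, θ (X i - z) * yukawa ν (X i - X j) * θ (X j - z)) * (‖ψ X‖₊ : ℝ≥0∞) ^ 2 ≠ ⊤ :=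
      ne_top_of_le_ne_top hPP (setLIntegral_le_lintegral _ _)
    have hc₀ : 0 ≤ g * ρ * (n * (M * (M * ∫ y, yukawa ν y))) := by positivity
    have hEc : 0 ≤ boxGroundStateEnergy κ g ρ θ ν n ℓ + g * ρ * (n * (M * (M * ∫ y, yukawa ν y))) := by
      have := boxGroundStateEnergy_ge (κ := κ) hκ hg hρ hθ hM hν hℓ (n := n)
      linarith
    have he : 0 ≤ g * ρ ^ 2 * boxBackgroundSelfEnergy θ ν + g * ρ * (n * (M * (M * ∫ y, yukawa ν y))) :=
      add_nonneg (mul_nonneg (mul_nonneg hg (sq_nonneg ρ)) hbb0) hc₀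
    have hreal := toReal_of_ofReal_mul_le hEc (mul_nonneg hg hρ) hκ hg he hμ hB' hK' hP' hGE
    nlinarith [hreal]
  -- sum the per-piece inequalities
  have hsum := Finset.sum_le_sum fun S (_ : S ∈ (Finset.univ : Finset (Finset (Fin N)))) => hS S
  rw [Finset.sum_add_distrib, Finset.sum_add_distrib, Finset.sum_add_distrib, ← Finset.mul_sum,
    ← Finset.mul_sum, ← Finset.mul_sum, ← Finset.mul_sum] at hsum
  -- the pieces partition configuration space
  have hSμ : ∑ S : Finset (Fin N), (∫⁻ X in {X : Config N | ∀ j, X j - z ∈ box ℓ ↔ j ∈ S}, (‖ψ X‖₊ : ℝ≥0∞) ^ 2).toReal = (∫⁻ X, (‖ψ X‖₊ : ℝ≥0∞) ^ 2).toReal := by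
    rw [← ENNReal.toReal_sum fun S _ => ne_top_of_le_ne_top hmass (setLIntegral_le_lintegral _ _),
      sum_setLIntegral_pieceSet ℓ z hW]
  have hSB : ∑ S : Finset (Fin N), (∫⁻ X in {X : Config N | ∀ j, X j - z ∈ box ℓ ↔ j ∈ S}, ENNReal.ofReal (∑ j, θ (X j - z) * smearedBackground θ ν (X j - z)) * (‖ψ X‖₊ : ℝ≥0∞) ^ 2).toReal =
      (∫⁻ X, ENNReal.ofReal (∑ j, θ (X j - z) * smearedBackground θ ν (X j - z)) * (‖ψ X‖₊ : ℝ≥0∞) ^ 2).toReal := by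
    rw [← ENNReal.toReal_sum fun S _ => ne_top_of_le_ne_top hPBtop (setLIntegral_le_lintegral _ _),
      sum_setLIntegral_pieceSet ℓ z hPBm]
  have hSK : ∑ S : Finset (Fin N), (∫⁻ X in {X : Config N | ∀ j, X j - z ∈ box ℓ ↔ j ∈ S}, ∑ j, (box ℓ).indicator (fun _ => (1 : ℝ≥0∞)) (X j - z) *
            ∑ k : Fin 3, (‖fderiv ℝ ψ X (Pi.single j (EuclideanSpace.single k (1 : ℝ)))‖₊ : ℝ≥0∞) ^ 2).toReal = (∫⁻ X, ∑ j, (box ℓ).indicator (fun _ => (1 : ℝ≥0∞)) (X j - z) *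
            ∑ k : Fin 3, (‖fderiv ℝ ψ X (Pi.single j (EuclideanSpace.single k (1 : ℝ)))‖₊ : ℝ≥0∞) ^ 2).toReal := by
    rw [← ENNReal.toReal_sum fun S _ => ne_top_of_le_ne_top hKINtop (setLIntegral_le_lintegral _ _),
      sum_setLIntegral_pieceSet ℓ z hKIN]
  have hSP : ∑ S : Finset (Fin N), (∫⁻ X in {X : Config N | ∀ j, X j - z ∈ box ℓ ↔ j ∈ S}, ENNReal.ofReal (∑ i, ∑ j with i < j, θ (X i - z) * yukawa ν (X i - X j) * θ (X j - z)) * (‖ψ X‖₊ : ℝ≥0∞) ^ 2).toReal =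
      (∫⁻ X, ENNReal.ofReal (∑ i, ∑ j with i < j, θ (X i - z) * yukawa ν (X i - X j) * θ (X j - z)) * (‖ψ X‖₊ : ℝ≥0∞) ^ 2).toReal := by
    rw [← ENNReal.toReal_sum fun S _ => ne_top_of_le_ne_top hPP (setLIntegral_le_lintegral _ _),
      sum_setLIntegral_pieceSet ℓ z hPPm]
  rw [hSμ, hSB, hSK, hSP] at hsum
  linarith

end Decomposition

end Literature.MathematicalPhysics.QuantumManyBody.JelliumBoseGas
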